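import Summits.QuantumFields.BalabanUV.T4Continuum.Support.DirichletMonotoneCutoffBounds
import Summits.QuantumFields.BalabanUV.T4Continuum.Support.RegionGaugeFixedVectorFlat

/-!
# `BalabanUV.T4Continuum.Support.DirichletSplitPieces` — NE2 (node U1a) formalisation swarm, SUPPLIER item «Δ1-LOCAL» under the
# owner's sub-row `T4-U1a.S-NE2-D1-DIRICHLET°` (wall `hinj`): LOCALLY SPLITTABLE block sets and the per-vertex admissible pieces of a
# lattice field (unit b2b-balaban-t4-ne2-formalise-leaf-08, gen 5, file 1 of 4: the combinatorics; file 2 `DirichletSplitVertex` = admissibility + the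
# per-vertex estimate; file 3 `DirichletLocalisedBesov` = the summed END; file 4 `DirichletSplittableTwoLevel` = two-level law + tower)

HONEST FRAMING.  Rung (B)+1 bookkeeping at MODEL level (U = 1 scalar layer), finite torus; pure lattice combinatorics; NE2 (U1a) is
NOT proved by this file; spine PROVED 0/9 unchanged; NOT infinite volume, NOT the mass gap, NOT Clay.  HONEST DEPENDENCY (verbatim):
«continuum YM on T⁴ ⇐ BetaPertH ∧ nine spine estimates (0/9 proved); BetaPertH ⇐ (D1) ∧ (D4) ∧ CAP+tail; G-an2-4 gates asym, D1 and
NE2/3/4.»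

WHAT THIS IS FOR.  Module (I) of «Δ1-BESOV» (`DirichletDirectionalBesov.nsq_sdiff_sdiff_le_of_admissible`, leaf-08 gen 3) bounds the
pure second differences `∂_μ∂_μ w` of ANY field `w` whose one-sided translate `T_{±e_μ}w − w` stays inside a region; module (II) realises
the admissibility by ONE GLOBAL cutoff `ψ_μ`, which exists iff EVERY vertex patch of the block set is monotone along `μ`
(`DirichletMonotoneCutoff.LocallyMonotone`).  THIS LINE OF FILES LOCALISES the argument: the field is split by module (II)'s exact
partition of unity `Σ_v bump v = 1` into vertex pieces `bump_v·z`, and each vertex piece is split ONCE MORE along a 2-colouring `σ` of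
the `S`-blocks of the patch of `v` that is CONSTANT ACROSS INTERNAL FACES (`AdjConst`): the `σ`-piece lives on a DOWNWARD-closed class
(translated by `+e_μ`), the `¬σ`-piece on an UPWARD-closed class (translated by `−e_μ`).  Because two `S`-blocks of different colours are
never bond-adjacent, the colour split costs nothing: every bond sees at most one colour.

WHAT THIS FILE PROVES (0 sorry).
 * §1 [shape] `AdjConst`, **`SplittableAt S v μ`** (`∃ σ, AdjConst ∧ DownClosed (S ⊓ σ) ∧ UpClosed (S ⊓ σᶜ)`), **`LocallySplittable S`**,
   `PillarFree S v μ` (no `μ`-adjacent PAIR of `S`-blocks in the patch), and the inclusions **`splittableAt_of_downClosed ∕ _of_upClosed ∕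
   _of_pillarFree`**, **`locallySplittable_of_locallyMonotone`** (module (II)'s class), **`locallySplittable_of_monotone_or_pillarFree`**
   (the checkable criterion: at every vertex and axis the patch is monotone OR pillar-free — e.g. a face-connected ring of blocks closing
   on itself through a corner contact, outside the classes of gen 3 ∕ gen 4);
 * §2 the pieces `piece P f = 1_{P(block)}·f` of the vertex field `f = bump_v·z` for the flags `flagD = InPatch ∧ S ∧ σ`,
   `flagU = InPatch ∧ S ∧ ¬σ`: recomposition `piece flagD f + piece flagU f = f`, flag agreement across bonds carrying `f` at both ends,
   POINTWISE GRADIENT DOMINATION `‖∂_ν(piece) x‖ ≤ ‖∂_ν f x‖`, LAPLACIAN AGREEMENT `Δ(piece) = Δ f` on the piece's own blocks, support;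
 (admissibility of the two pieces for the one-sided translations is file 2's §1).

ABSOLUTE RULE (cell, verbatim): «No internally-minted statement may enter as a cited fact. Every hypothesis is either kernel-proved in
this package or a verbatim quotation of a PUBLISHED theorem with page reference. The manuscript(s) under audit are NOT citable for
their own disputed steps — they are the thing under adjudication; programme-internal (2001/route/tribunal) claims are never citable.»
[folklore] throughout; parametrised shape predicates and data defs only; no `def … : Prop` fact.  NOT CLAIMED: anything about a vertex
patch that is non-monotone along `μ` AND carries a `μ`-pillar inside the conflicting component (the spiral 4-chain of cubes around a vertex,
d ≥ 3 — intrinsically non-Lipschitz; no one-sided splitting exists there at any scale); the VECTOR layer; rate `L^{−1}`; NE2; NE3;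
«not in print; our construction».
-/

noncomputable section

open scoped BigOperators ComplexConjugate Matrix
open Finset

namespace Summit.QuantumFields.BalabanUV.T4Continuum.DirichletSplitPieces

open Literature.MathematicalPhysics.QuantumFieldTheory.Balaban1983to89.B5Prop11Plancherel (Tor fine unitVec)
open Literature.MathematicalPhysics.QuantumFieldTheory.Balaban1983to89.B5Action121 (sdiff LapS sdiff_mulVec LapS_mulVec)
open Literature.MathematicalPhysics.QuantumFieldTheory.Balaban1983to89.B5Blocks16 (blockOf)
open Summit.QuantumFields.BalabanUV.T4Continuum.ScalarBlockPoincare (transS)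
open Summit.QuantumFields.BalabanUV.T4Continuum.RegionGaugeFixedVectorFlat (blockOf_add_unitVec)
open Summit.QuantumFields.BalabanUV.T4Continuum.DirichletDirectionalBesovCutoff (cut)
open Summit.QuantumFields.BalabanUV.T4Continuum.DirichletMonotoneCutoff (rampUp_zero rampDn_last offsF blockOf_offsF_add_of_lt
  blockOf_offsF_add_of_eq blockOf_offsF_sub bump axisF_ne_zero axisF_ne_zero_of_bump_ne_zero inPatch_of_bump_ne_zero InPatch DownClosed
  UpClosed LocallyMonotone)

variable {d : ℕ}

/-! ## §1 Locally splittable block sets -/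

section Shape

variable (M : Fin d → ℕ) [hM : ∀ μ, NeZero (M μ)]

/-- [shape] the colouring `σ` is CONSTANT ACROSS INTERNAL FACES of the patch of `v`: two face-adjacent `S`-blocks of the patch have the
same colour. [folklore] -/
def AdjConst (S σ : Tor M → Prop) (v : Tor M) : Prop :=
  ∀ b ν, InPatch M v b → InPatch M v (b + unitVec M ν) → S b → S (b + unitVec M ν) → (σ b ↔ σ (b + unitVec M ν))

/-- [shape] **the patch of `v` is SPLITTABLE along `μ`**: its `S`-blocks 2-colour, constantly across internal faces, into a
DOWNWARD-closed class `S ⊓ σ` and an UPWARD-closed class `S ⊓ σᶜ`. [folklore] -/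
def SplittableAt (S : Tor M → Prop) (v : Tor M) (μ : Fin d) : Prop :=
  ∃ σ : Tor M → Prop, AdjConst M S σ v ∧ DownClosed M (fun b => S b ∧ σ b) v μ ∧ UpClosed M (fun b => S b ∧ ¬ σ b) v μ

/-- [shape] **LOCALLY SPLITTABLE block set**: every vertex patch is splittable along every axis. [folklore] -/
def LocallySplittable (S : Tor M → Prop) : Prop := ∀ v μ, SplittableAt M S v μ

/-- [shape] the patch of `v` is PILLAR-FREE along `μ`: it contains no `μ`-adjacent pair of `S`-blocks (lower block and its upper
neighbour both in `S`) — unless the torus is degenerate along `μ` (`e_μ = 0`). [folklore] -/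
def PillarFree (S : Tor M → Prop) (v : Tor M) (μ : Fin d) : Prop :=
  ∀ b, InPatch M v b → v μ = b μ + 1 → S b → S (b + unitVec M μ) → unitVec M μ = 0

omit hM in
/-- a degenerate axis: `(1 : ZMod (M μ)) = 0` forces `e_μ = 0`. [folklore] -/
theorem unitVec_eq_zero_of_one_eq_zero {μ : Fin d} (h : (1 : ZMod (M μ)) = 0) : unitVec M μ = 0 := by
  rw [unitVec, h, Pi.single_zero]

omit hM in
/-- the `μ`-component of `e_μ` is `1`, the others vanish. [folklore] -/
theorem add_unitVec_apply_self (b : Tor M) (μ : Fin d) : (b + unitVec M μ) μ = b μ + 1 := by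
  simp [unitVec]

omit hM in
/-- … [folklore] -/
theorem add_unitVec_apply_ne (b : Tor M) {μ ν : Fin d} (h : ν ≠ μ) : (b + unitVec M μ) ν = b ν := by
  simp [unitVec, h]

omit hM in
/-- … [folklore] -/
theorem sub_unitVec_apply_self (b : Tor M) (μ : Fin d) : (b - unitVec M μ) μ = b μ - 1 := by
  simp [unitVec]

omit hM in
/-- … [folklore] -/
theorem sub_unitVec_apply_ne (b : Tor M) {μ ν : Fin d} (h : ν ≠ μ) : (b - unitVec M μ) ν = b ν := by
  simp [unitVec, h]

omit hM in
/-- the lower neighbour of an UPPER patch block is a (lower) patch block. [folklore] -/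
theorem inPatch_sub_of_upper {v b : Tor M} (hP : InPatch M v b) {μ : Fin d} (hu : v μ = b μ) : InPatch M v (b - unitVec M μ) := by
  intro ν
  by_cases hν : ν = μ
  · subst hν; left; rw [sub_unitVec_apply_self, sub_add_cancel]; exact hu
  · rw [sub_unitVec_apply_ne M b hν]; exact hP ν

omit hM in
/-- the upper neighbour of a LOWER patch block is an (upper) patch block. [folklore] -/
theorem inPatch_add_of_lower {v b : Tor M} (hP : InPatch M v b) {μ : Fin d} (hl : v μ = b μ + 1) : InPatch M v (b + unitVec M μ) := by
  intro ν
  by_cases hν : ν = μ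
  · subst hν; right; rw [add_unitVec_apply_self]; exact hl
  · rw [add_unitVec_apply_ne M b hν]; exact hP ν

omit hM in
/-- a DOWNWARD-closed patch is splittable (colour everything `σ ≡ ⊤`). [folklore] -/
theorem splittableAt_of_downClosed {S : Tor M → Prop} {v : Tor M} {μ : Fin d} (h : DownClosed M S v μ) : SplittableAt M S v μ :=
  ⟨fun _ => True, fun _ _ _ _ _ _ => Iff.rfl, fun b hP hμ hS => ⟨h b hP hμ hS.1, trivial⟩, fun _ _ _ hS => absurd trivial hS.2⟩

omit hM in
/-- an UPWARD-closed patch is splittable (`σ ≡ ⊥`). [folklore] -/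
theorem splittableAt_of_upClosed {S : Tor M → Prop} {v : Tor M} {μ : Fin d} (h : UpClosed M S v μ) : SplittableAt M S v μ :=
  ⟨fun _ => False, fun _ _ _ _ _ _ => Iff.rfl, fun _ _ _ hS => hS.2.elim, fun b hP hμ hS => ⟨h b hP hμ hS.1, not_false⟩⟩

omit hM in
/-- **a PILLAR-FREE patch is splittable**: colour a block by «lower along `μ`»; with no `μ`-pillar no internal face separates the two
colours, the lower class is (vacuously) downward-closed and the upper class upward-closed. [folklore] -/
theorem splittableAt_of_pillarFree {S : Tor M → Prop} {v : Tor M} {μ : Fin d} (h : PillarFree M S v μ) : SplittableAt M S v μ := by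
  refine ⟨fun b => v μ = b μ + 1, fun b ν hP hP' hS hS' => ?_, fun b hP hu hS => ?_, fun b hP hl hS => absurd hl hS.2⟩
  · -- colour constancy across an internal face `b | b + e_ν`
    show v μ = b μ + 1 ↔ v μ = (b + unitVec M ν) μ + 1
    by_cases hν : ν = μ
    · rw [hν] at hP' hS' ⊢
      by_cases hl : v μ = b μ + 1
      · -- `b` lower and `b + e_μ ∈ S`: a pillar, so the axis is degenerate
        rw [h b hP hl hS hS', add_zero]
      · -- `b` upper; then `b + e_μ` is lower, and `b + 2e_μ = b` closes a pillar at `b + e_μ`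
        have hu : v μ = b μ := (hP μ).resolve_left hl
        have hl' : v μ = (b + unitVec M μ) μ + 1 := by
          rcases hP' μ with h1 | h2
          · exact h1
          · rw [add_unitVec_apply_self] at h2; exact absurd h2 hl
        have h2 : (1 : ZMod (M μ)) + 1 = 0 := by
          have h' := hl'
          rw [add_unitVec_apply_self, hu] at h'
          linear_combination -h'
        have hbb : b + unitVec M μ + unitVec M μ = b := by
          rw [add_assoc, unitVec, ← Pi.single_add, h2, Pi.single_zero, add_zero]
        have h0 := h (b + unitVec M μ) hP' hl' hS' (by rw [hbb]; exact hS)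
        have h10 : (1 : ZMod (M μ)) = 0 := by
          have := congr_fun h0 μ; simpa [unitVec] using this
        exact absurd (by rw [hu, h10, add_zero]) hl
    · rw [add_unitVec_apply_ne M b fun h' => hν h'.symm]
  · -- downward closure of the lower class: an upper block that is also lower forces a degenerate axis
    show S (b - unitVec M μ) ∧ v μ = (b - unitVec M μ) μ + 1
    have h10 : (1 : ZMod (M μ)) = 0 := by
      have h' := hS.2; rw [hu] at h'; linear_combination -h'
    rw [unitVec_eq_zero_of_one_eq_zero M h10, sub_zero]
    exact hS

omit hM in
/-- module (II)'s class is contained: **every locally monotone block set is locally splittable**. [folklore] -/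
theorem locallySplittable_of_locallyMonotone {S : Tor M → Prop} (h : LocallyMonotone M S) : LocallySplittable M S := fun v μ => by
  rcases h v μ with hD | hU
  · exact splittableAt_of_downClosed M hD
  · exact splittableAt_of_upClosed M hU

omit hM in
/-- **the checkable criterion**: if at every vertex and axis the patch is downward-closed, upward-closed OR pillar-free, the block set
is locally splittable. [folklore] -/
theorem locallySplittable_of_monotone_or_pillarFree {S : Tor M → Prop}
    (h : ∀ v μ, DownClosed M S v μ ∨ UpClosed M S v μ ∨ PillarFree M S v μ) : LocallySplittable M S := fun v μ => by
  rcases h v μ with hD | hU | hF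
  · exact splittableAt_of_downClosed M hD
  · exact splittableAt_of_upClosed M hU
  · exact splittableAt_of_pillarFree M hF

omit hM in
/-- colour constancy in the symmetric form used below: for `S`-blocks `b, b'` of the patch with `b' = b + e_ν` or `b = b' + e_ν`.
[folklore] -/
theorem AdjConst.iff_of_adj {S σ : Tor M → Prop} {v : Tor M} (hA : AdjConst M S σ v) {b b' : Tor M} {ν : Fin d}
    (hb : InPatch M v b) (hb' : InPatch M v b') (hS : S b) (hS' : S b') (hadj : b' = b + unitVec M ν ∨ b = b' + unitVec M ν) :
    (σ b ↔ σ b') := by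
  rcases hadj with rfl | rfl
  · exact hA b ν hb hb' hS hS'
  · exact (hA b' ν hb' hb hS' hS).symm

end Shape

/-! ## §2 The pieces of a vertex field -/

section Pieces

variable (n : ℕ) [NeZero n] (M : Fin d → ℕ) [hM : ∀ μ, NeZero (M μ)]

open Classical in
/-- the piece of `f` on the blocks flagged by `P`: `piece P f = 1_{P(blockOf ·)}·f`. [folklore] -/
def piece (P : Tor M → Prop) (f : Tor (fine n M) → ℂ) : Tor (fine n M) → ℂ := fun x => if P (blockOf n M x) then f x else 0

/-- [shape] the DOWN flag of the colouring `σ` at the vertex `v`: patch blocks of `S` coloured `σ`. [folklore] -/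
def flagD (S σ : Tor M → Prop) (v : Tor M) : Tor M → Prop := fun b => InPatch M v b ∧ S b ∧ σ b

/-- [shape] the UP flag: patch blocks of `S` coloured `¬σ`. [folklore] -/
def flagU (S σ : Tor M → Prop) (v : Tor M) : Tor M → Prop := fun b => InPatch M v b ∧ S b ∧ ¬ σ b

/-- the vertex field `f_v = bump_v · z`. [folklore] -/
def vfield (v : Tor M) (z : Tor (fine n M) → ℂ) : Tor (fine n M) → ℂ := cut (fine n M) (bump n M v) z

/-- `piece P f x = f x` on a flagged block. [folklore] -/
theorem piece_apply_of_pos {P : Tor M → Prop} (f : Tor (fine n M) → ℂ) {x : Tor (fine n M)} (h : P (blockOf n M x)) :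
    piece n M P f x = f x := by
  unfold piece; rw [if_pos h]

/-- `piece P f x = 0` off the flagged blocks. [folklore] -/
theorem piece_apply_of_neg {P : Tor M → Prop} (f : Tor (fine n M) → ℂ) {x : Tor (fine n M)} (h : ¬ P (blockOf n M x)) :
    piece n M P f x = 0 := by
  unfold piece; rw [if_neg h]

/-- `‖piece P f x‖ ≤ ‖f x‖`. [folklore] -/
theorem norm_piece_le (P : Tor M → Prop) (f : Tor (fine n M) → ℂ) (x : Tor (fine n M)) : ‖piece n M P f x‖ ≤ ‖f x‖ := by
  unfold piece; split_ifs
  · exact le_rfl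
  · rw [norm_zero]; exact norm_nonneg _

/-- a non-zero value of the vertex field puts the block in the patch of `v` and in `S` (for `z` supported in the block region of `S`).
[folklore] -/
theorem mem_of_vfield_ne_zero {S : Tor M → Prop} {v : Tor M} {z : Tor (fine n M) → ℂ} (hz : ∀ x, ¬ S (blockOf n M x) → z x = 0)
    {x : Tor (fine n M)} (h : vfield n M v z x ≠ 0) : InPatch M v (blockOf n M x) ∧ S (blockOf n M x) ∧ bump n M v x ≠ 0 := by
  unfold vfield cut at h
  have hb : bump n M v x ≠ 0 := fun h0 => h (by rw [h0, Complex.ofReal_zero, zero_mul])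
  have hzx : z x ≠ 0 := fun h0 => h (by rw [h0, mul_zero])
  exact ⟨inPatch_of_bump_ne_zero n M hb, by_contra fun hS => hzx (hz x hS), hb⟩

/-- a non-zero value of the vertex field is a non-zero value of the bump. [folklore] -/
theorem bump_ne_zero_of_vfield_ne_zero {v : Tor M} {z : Tor (fine n M) → ℂ} {x : Tor (fine n M)} (h : vfield n M v z x ≠ 0) :
    bump n M v x ≠ 0 := fun h0 =>
  h (show ((bump n M v x : ℝ) : ℂ) * z x = 0 by rw [h0, Complex.ofReal_zero, zero_mul])

/-- **recomposition**: `piece flagD f_v + piece flagU f_v = f_v`. [folklore] -/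
theorem piece_add_piece {S : Tor M → Prop} (σ : Tor M → Prop) {v : Tor M} {z : Tor (fine n M) → ℂ}
    (hz : ∀ x, ¬ S (blockOf n M x) → z x = 0) :
    piece n M (flagD M S σ v) (vfield n M v z) + piece n M (flagU M S σ v) (vfield n M v z) = vfield n M v z := by
  funext x
  rw [Pi.add_apply]
  by_cases hf : vfield n M v z x = 0
  · unfold piece; rw [hf]; split_ifs <;> simp
  · obtain ⟨hP, hS, -⟩ := mem_of_vfield_ne_zero n M hz hf
    by_cases hσ : σ (blockOf n M x)
    · rw [piece_apply_of_pos n M _ (show flagD M S σ v _ from ⟨hP, hS, hσ⟩),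
        piece_apply_of_neg n M _ (show ¬ flagU M S σ v _ from fun h => h.2.2 hσ), add_zero]
    · rw [piece_apply_of_neg n M _ (show ¬ flagD M S σ v _ from fun h => hσ h.2.2),
        piece_apply_of_pos n M _ (show flagU M S σ v _ from ⟨hP, hS, hσ⟩), zero_add]

/-- **FLAG AGREEMENT**: if `f_v` is non-zero at a neighbour `y ∈ {x ± e_ν}` of a site `x` in a DOWN-flagged block, the block of `y`
is DOWN-flagged too (colour constancy across internal faces). [folklore] -/
theorem flagD_of_adj {S σ : Tor M → Prop} {v : Tor M} (hA : AdjConst M S σ v) {z : Tor (fine n M) → ℂ}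
    (hz : ∀ x, ¬ S (blockOf n M x) → z x = 0) {x y : Tor (fine n M)} {ν : Fin d}
    (hxy : y = x + unitVec (fine n M) ν ∨ x = y + unitVec (fine n M) ν)
    (hx : flagD M S σ v (blockOf n M x)) (hy : vfield n M v z y ≠ 0) : flagD M S σ v (blockOf n M y) := by
  obtain ⟨hPy, hSy, -⟩ := mem_of_vfield_ne_zero n M hz hy
  refine ⟨hPy, hSy, ?_⟩
  have hadj : blockOf n M y = blockOf n M x ∨ (blockOf n M y = blockOf n M x + unitVec M ν ∨ blockOf n M x = blockOf n M y + unitVec M ν) := by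
    rcases hxy with rfl | rfl
    · rcases blockOf_add_unitVec n M x ν with h | h
      · exact Or.inl h
      · exact Or.inr (Or.inl h)
    · rcases blockOf_add_unitVec n M y ν with h | h
      · exact Or.inl h.symm
      · exact Or.inr (Or.inr h)
  rcases hadj with h | h
  · rw [h]; exact hx.2.2
  · exact (hA.iff_of_adj M hx.1 hPy hx.2.1 hSy h).mp hx.2.2

/-- … and the same for the UP flag. [folklore] -/
theorem flagU_of_adj {S σ : Tor M → Prop} {v : Tor M} (hA : AdjConst M S σ v) {z : Tor (fine n M) → ℂ}
    (hz : ∀ x, ¬ S (blockOf n M x) → z x = 0) {x y : Tor (fine n M)} {ν : Fin d}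
    (hxy : y = x + unitVec (fine n M) ν ∨ x = y + unitVec (fine n M) ν)
    (hx : flagU M S σ v (blockOf n M x)) (hy : vfield n M v z y ≠ 0) : flagU M S σ v (blockOf n M y) := by
  obtain ⟨hPy, hSy, -⟩ := mem_of_vfield_ne_zero n M hz hy
  refine ⟨hPy, hSy, ?_⟩
  have hadj : blockOf n M y = blockOf n M x ∨ (blockOf n M y = blockOf n M x + unitVec M ν ∨ blockOf n M x = blockOf n M y + unitVec M ν) := by
    rcases hxy with rfl | rfl
    · rcases blockOf_add_unitVec n M x ν with h | h
      · exact Or.inl h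
      · exact Or.inr (Or.inl h)
    · rcases blockOf_add_unitVec n M y ν with h | h
      · exact Or.inl h.symm
      · exact Or.inr (Or.inr h)
  rcases hadj with h | h
  · rw [h]; exact hx.2.2
  · exact fun hσ => hx.2.2 ((hA.iff_of_adj M hx.1 hPy hx.2.1 hSy h).mpr hσ)

/-- [shape] a flag `P` PROPAGATES along the vertex field: from a `P`-block to any neighbouring site where `f_v ≠ 0`.  Both `flagD` and
`flagU` propagate (the two lemmas above); everything below is proved for a propagating flag. [folklore] -/
def Propagates (P : Tor M → Prop) (v : Tor M) (z : Tor (fine n M) → ℂ) : Prop :=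
  ∀ x y (ν : Fin d), (y = x + unitVec (fine n M) ν ∨ x = y + unitVec (fine n M) ν) →
    P (blockOf n M x) → vfield n M v z y ≠ 0 → P (blockOf n M y)

/-- `flagD` propagates. [folklore] -/
theorem propagates_flagD {S σ : Tor M → Prop} {v : Tor M} (hA : AdjConst M S σ v) {z : Tor (fine n M) → ℂ}
    (hz : ∀ x, ¬ S (blockOf n M x) → z x = 0) : Propagates n M (flagD M S σ v) v z :=
  fun _ _ _ hxy hx hy => flagD_of_adj n M hA hz hxy hx hy

/-- `flagU` propagates. [folklore] -/
theorem propagates_flagU {S σ : Tor M → Prop} {v : Tor M} (hA : AdjConst M S σ v) {z : Tor (fine n M) → ℂ}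
    (hz : ∀ x, ¬ S (blockOf n M x) → z x = 0) : Propagates n M (flagU M S σ v) v z :=
  fun _ _ _ hxy hx hy => flagU_of_adj n M hA hz hxy hx hy

/-- on a propagating flag, the piece agrees with `f_v` at every NEIGHBOUR of a flagged site. [folklore] -/
theorem piece_eq_of_adj {P : Tor M → Prop} {v : Tor M} {z : Tor (fine n M) → ℂ} (hP : Propagates n M P v z) {x y : Tor (fine n M)}
    {ν : Fin d} (hxy : y = x + unitVec (fine n M) ν ∨ x = y + unitVec (fine n M) ν) (hx : P (blockOf n M x)) :
    piece n M P (vfield n M v z) y = vfield n M v z y := by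
  by_cases hy : vfield n M v z y = 0
  · unfold piece; rw [hy]; split_ifs <;> rfl
  · exact piece_apply_of_pos n M _ (hP x y ν hxy hx hy)

/-- **POINTWISE GRADIENT DOMINATION**: `‖∂_ν(piece) x‖ ≤ ‖∂_ν f_v x‖` at every site (every bond sees at most one colour). [folklore] -/
theorem norm_sdiff_piece_le {P : Tor M → Prop} {v : Tor M} {z : Tor (fine n M) → ℂ} (hP : Propagates n M P v z) (c : ℂ)
    (ν : Fin d) (x : Tor (fine n M)) :
    ‖(sdiff (fine n M) c ν *ᵥ piece n M P (vfield n M v z)) x‖ ≤ ‖(sdiff (fine n M) c ν *ᵥ vfield n M v z) x‖ := by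
  rw [sdiff_mulVec, sdiff_mulVec, norm_mul, norm_mul]
  refine mul_le_mul_of_nonneg_left ?_ (norm_nonneg c)
  set y := x + unitVec (fine n M) ν with hy
  by_cases hx : P (blockOf n M x)
  · rw [piece_apply_of_pos n M _ hx, piece_eq_of_adj n M hP (Or.inl hy) hx]
  · rw [piece_apply_of_neg n M _ hx, sub_zero]
    by_cases hyP : P (blockOf n M y)
    · -- `x` unflagged, `y` flagged: then `f_v x = 0` by propagation from `y`
      have hfx : vfield n M v z x = 0 := by
        by_contra h; exact hx (hP y x ν (Or.inr hy) hyP h)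
      rw [piece_apply_of_pos n M _ hyP, hfx, sub_zero]
    · rw [piece_apply_of_neg n M _ hyP, norm_zero]; exact norm_nonneg _

/-- **LAPLACIAN AGREEMENT on the flagged blocks**: `(Δ piece)(x) = (Δ f_v)(x)` for `x` in a `P`-block. [folklore] -/
theorem LapS_piece_eq {P : Tor M → Prop} {v : Tor M} {z : Tor (fine n M) → ℂ} (hP : Propagates n M P v z) (c : ℂ)
    {x : Tor (fine n M)} (hx : P (blockOf n M x)) :
    (LapS (fine n M) c *ᵥ piece n M P (vfield n M v z)) x = (LapS (fine n M) c *ᵥ vfield n M v z) x := by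
  rw [LapS_mulVec, LapS_mulVec]
  refine Finset.sum_congr rfl fun ν _ => ?_
  rw [piece_apply_of_pos n M _ hx, piece_eq_of_adj n M hP (Or.inl rfl) hx,
    piece_eq_of_adj n M hP (ν := ν) (Or.inr (sub_add_cancel x _).symm) hx]

/-- support: a non-zero value of a piece is a non-zero value of `f_v`, hence of the bump. [folklore] -/
theorem bump_ne_zero_of_piece_ne_zero {P : Tor M → Prop} {v : Tor M} {z : Tor (fine n M) → ℂ} {x : Tor (fine n M)}
    (h : piece n M P (vfield n M v z) x ≠ 0) : bump n M v x ≠ 0 := by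
  unfold piece at h
  split_ifs at h with hx
  · unfold vfield cut at h
    exact fun h0 => h (by rw [h0, Complex.ofReal_zero, zero_mul])
  · exact absurd rfl h

end Pieces

end Summit.QuantumFields.BalabanUV.T4Continuum.DirichletSplitPieces

end
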